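import Summits.AnomalousDissipation.AnomalousDissipation.Theorems.SawtoothPulseCascadeK1LocalisedCascadePhaseOneStartSeries

/-!
# K1loc, line `Spectral` / thin start — helper: PHASE-TWO START BOX V — the numeric series of the strip `S_1(20)`

Helper file of the prover lane on the crux `K1LocalisedCascade` (stmt-AnomalousDissipation-19491), route `SawtoothPulseCascade`
(glue seat; start box of record `StartBoxTwo`, arbiter A23-13 (1): E_2 ≤ 0.05 with first-order CT dischargers).  Twin of
`…PhaseTwoStartBoxSeries` at the wider strip `K = 20` — the window at which the T-H junk of phase 1 becomes corner-trace-able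
(every `a₁`-fibre `|k₀| ≥ 20` has its H-lobe `8|k₀| ≥ 160` above the low-fibre window `K′ = 130`; sizing memo
`CT-PHASE1-SIZING-k1locp3g4.md`).  Pure real arithmetic: the series hypothesis of `K1Start.phaseOne_strip_le_of_series` at `K = 20`,
  `β₂₀(m) = [2 ≤ m]·w(m)·min(1, (√L₂₀(m) + mε)²)`,  `L₂₀(m) = 21·(16m/(π(64m² − 400)))²` (`8m > 20` for `m ≥ 3`; `w(2) = 0`),
`w` the weight table of `…ExactChirpSelf`, `ε ≤ 2⁻²⁵`:  **`Σ_{m∈T} β₂₀(m) ≤ 31/10000` for every finite `T ⊆ ℕ`** (`sum_strip20_series_le`).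
Head `m ≤ 16` term by term (`m = 3, 5, 7, 8, 9, 11, 13, 15` carry `13.6, 1.6, 4.1, 6.4, 2.2, 0.18, 0.05, 0.02 × 10⁻⁴`), middle
`17 ≤ m ≤ 2²⁰` by `w(m)L₂₀(m) ≤ 9.8/(π⁴m⁴)` (`64m² − 400 ≥ 62m²`), tail `m > 2²⁰` by the cap and `w ≤ 6.6/(π²m²)`.  Value of record:
the series is `≈ 2.82·10⁻³`; with it `S_1(20) ≤ (16/(63π))² + 62/10000 + O(2⁻²⁵) ≤ 0.0128` (truth `0.0091`, exact chirps).
No definitions; nothing about the crux. [folklore] [problem: turb]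
-/

-- `Summit.<Summit>.<Problem>`: single-conjunct summit, the duplicate namespace segment is deliberate.
set_option linter.dupNamespace false

noncomputable section

namespace Summit.AnomalousDissipation.AnomalousDissipation.Theorems.SawtoothPulseCascade.K1Start

open Finset Real

/-! ## §1 Termwise majorants at `K = 20` -/

/-- **Odd fibres `m ≥ 3`**: `β₂₀(m) ≤ (17/16)·(1/(8+m) + 1/|8−m|)²·(21(16m)²/((8m)²−400)²)·(1/π⁴) + 17m²ε²`. [folklore] -/
theorem strip20_term_le_of_odd {m : ℕ} (hm : Odd m) (hm3 : 3 ≤ m) {ε : ℝ} :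
    (if 2 ≤ m then (1 : ℝ) else 0) *
        ((if Odd m then (1 / (π * ((8 : ℝ) + m)) + 1 / (π * |(8 : ℝ) - m|)) ^ 2 else if m = 8 then (1 / 4 : ℝ) else 0) *
          min 1 ((Real.sqrt (if 8 * m ≤ (20 : ℕ) then (1 : ℝ) else
            (((20 : ℕ) : ℝ) + 1) * (2 * (8 * (m : ℝ)) / (π * ((8 * (m : ℝ)) ^ 2 - ((20 : ℕ) : ℝ) ^ 2))) ^ 2) + m * ε) ^ 2)) ≤
      17 / 16 * ((1 / ((8 : ℝ) + m) + 1 / |(8 : ℝ) - m|) ^ 2 * (21 * (16 * (m : ℝ)) ^ 2 / ((8 * (m : ℝ)) ^ 2 - 400) ^ 2)) *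
          (1 / π ^ 4) + 17 * (m : ℝ) ^ 2 * ε ^ 2 := by
  have hπ : 0 < π := Real.pi_pos
  have hm2 : 2 ≤ m := by omega
  have h8m : ¬ 8 * m ≤ (20 : ℕ) := by omega
  have hm8 : m ≠ 8 := by rintro rfl; exact (by decide : ¬ Odd 8) hm
  rw [if_pos hm2, one_mul, if_pos hm, if_neg h8m]
  have hmr : (3 : ℝ) ≤ m := by exact_mod_cast hm3
  have hden : 0 < (8 * (m : ℝ)) ^ 2 - 400 := by nlinarith
  have hcast : (((20 : ℕ) : ℝ) + 1) * (2 * (8 * (m : ℝ)) / (π * ((8 * (m : ℝ)) ^ 2 - ((20 : ℕ) : ℝ) ^ 2))) ^ 2 =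
      21 * (16 * (m : ℝ)) ^ 2 / ((8 * (m : ℝ)) ^ 2 - 400) ^ 2 * (1 / π ^ 2) := by
    push_cast
    field_simp
    ring
  rw [hcast]
  set L : ℝ := 21 * (16 * (m : ℝ)) ^ 2 / ((8 * (m : ℝ)) ^ 2 - 400) ^ 2 * (1 / π ^ 2) with hL
  have hL0 : 0 ≤ L := by positivity
  have hw0 : 0 ≤ (1 / (π * ((8 : ℝ) + m)) + 1 / (π * |(8 : ℝ) - m|)) ^ 2 := sq_nonneg _
  have hw1 := odd_weight_le_one hm8 (m := m)
  have hmin : min 1 ((Real.sqrt L + m * ε) ^ 2) ≤ 17 / 16 * L + 17 * (m * ε) ^ 2 :=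
    (min_le_right _ _).trans (sq_sqrt_add_le hL0)
  have hid : (1 / (π * ((8 : ℝ) + m)) + 1 / (π * |(8 : ℝ) - m|)) ^ 2 * L =
      (1 / ((8 : ℝ) + m) + 1 / |(8 : ℝ) - m|) ^ 2 * (21 * (16 * (m : ℝ)) ^ 2 / ((8 * (m : ℝ)) ^ 2 - 400) ^ 2) * (1 / π ^ 4) := by
    have ha : (8 : ℝ) + m ≠ 0 := by positivity
    have hb : |(8 : ℝ) - m| ≠ 0 := by
      rw [abs_ne_zero, sub_ne_zero]; exact_mod_cast (Ne.symm hm8)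
    rw [hL]
    field_simp
  calc (1 / (π * ((8 : ℝ) + m)) + 1 / (π * |(8 : ℝ) - m|)) ^ 2 * min 1 ((Real.sqrt L + m * ε) ^ 2)
      ≤ (1 / (π * ((8 : ℝ) + m)) + 1 / (π * |(8 : ℝ) - m|)) ^ 2 * (17 / 16 * L + 17 * (m * ε) ^ 2) :=
        mul_le_mul_of_nonneg_left hmin hw0
    _ = 17 / 16 * ((1 / (π * ((8 : ℝ) + m)) + 1 / (π * |(8 : ℝ) - m|)) ^ 2 * L) +
          (1 / (π * ((8 : ℝ) + m)) + 1 / (π * |(8 : ℝ) - m|)) ^ 2 * (17 * (m * ε) ^ 2) := by ring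
    _ ≤ 17 / 16 * ((1 / ((8 : ℝ) + m) + 1 / |(8 : ℝ) - m|) ^ 2 * (21 * (16 * (m : ℝ)) ^ 2 / ((8 * (m : ℝ)) ^ 2 - 400) ^ 2) *
          (1 / π ^ 4)) + 1 * (17 * (m * ε) ^ 2) := by
        rw [hid]; gcongr
    _ = _ := by ring

/-- **The cap**: `β₂₀(m) ≤ w(m)` for every `m` (`min ≤ 1`). [folklore] -/
theorem strip20_term_le_weight (m : ℕ) {ε : ℝ} :
    (if 2 ≤ m then (1 : ℝ) else 0) *
        ((if Odd m then (1 / (π * ((8 : ℝ) + m)) + 1 / (π * |(8 : ℝ) - m|)) ^ 2 else if m = 8 then (1 / 4 : ℝ) else 0) *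
          min 1 ((Real.sqrt (if 8 * m ≤ (20 : ℕ) then (1 : ℝ) else
            (((20 : ℕ) : ℝ) + 1) * (2 * (8 * (m : ℝ)) / (π * ((8 * (m : ℝ)) ^ 2 - ((20 : ℕ) : ℝ) ^ 2))) ^ 2) + m * ε) ^ 2)) ≤
      (if Odd m then (1 / (π * ((8 : ℝ) + m)) + 1 / (π * |(8 : ℝ) - m|)) ^ 2 else if m = 8 then (1 / 4 : ℝ) else 0) := by
  have hw0 : 0 ≤ (if Odd m then (1 / (π * ((8 : ℝ) + m)) + 1 / (π * |(8 : ℝ) - m|)) ^ 2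
      else if m = 8 then (1 / 4 : ℝ) else 0) := by split_ifs <;> positivity
  have hmin0 : 0 ≤ min 1 ((Real.sqrt (if 8 * m ≤ (20 : ℕ) then (1 : ℝ) else
      (((20 : ℕ) : ℝ) + 1) * (2 * (8 * (m : ℝ)) / (π * ((8 * (m : ℝ)) ^ 2 - ((20 : ℕ) : ℝ) ^ 2))) ^ 2) + m * ε) ^ 2) :=
    le_min zero_le_one (sq_nonneg _)
  have hmin1 : min 1 ((Real.sqrt (if 8 * m ≤ (20 : ℕ) then (1 : ℝ) else
      (((20 : ℕ) : ℝ) + 1) * (2 * (8 * (m : ℝ)) / (π * ((8 * (m : ℝ)) ^ 2 - ((20 : ℕ) : ℝ) ^ 2))) ^ 2) + m * ε) ^ 2) ≤ 1 :=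
    min_le_left _ _
  have hind : (if 2 ≤ m then (1 : ℝ) else 0) ≤ 1 := by split_ifs <;> norm_num
  have hind0 : 0 ≤ (if 2 ≤ m then (1 : ℝ) else 0) := by split_ifs <;> norm_num
  calc _ ≤ 1 * ((if Odd m then (1 / (π * ((8 : ℝ) + m)) + 1 / (π * |(8 : ℝ) - m|)) ^ 2 else if m = 8 then (1 / 4 : ℝ) else 0) * 1) := by
        exact mul_le_mul hind (mul_le_mul_of_nonneg_left hmin1 hw0) (mul_nonneg hw0 hmin0) zero_le_one
    _ = _ := by ring

/-- **Middle/tail, fibres `m ≥ 17`**: `β₂₀(m) ≤ (578/225)²(17/16)(5376/3844)·(1/π⁴)/m⁴ + 17(578/225)²(1/π²)ε²`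
(`w ≤ (578/225)²/(π²m²)`, `L₂₀ ≤ (5376/3844)/(π²m²)` from `64m² − 400 ≥ 62m²`; even `m`: the weight vanishes). [folklore] -/
theorem strip20_term_le_of_ge {m : ℕ} (hm : 17 ≤ m) {ε : ℝ} :
    (if 2 ≤ m then (1 : ℝ) else 0) *
        ((if Odd m then (1 / (π * ((8 : ℝ) + m)) + 1 / (π * |(8 : ℝ) - m|)) ^ 2 else if m = 8 then (1 / 4 : ℝ) else 0) *
          min 1 ((Real.sqrt (if 8 * m ≤ (20 : ℕ) then (1 : ℝ) else
            (((20 : ℕ) : ℝ) + 1) * (2 * (8 * (m : ℝ)) / (π * ((8 * (m : ℝ)) ^ 2 - ((20 : ℕ) : ℝ) ^ 2))) ^ 2) + m * ε) ^ 2)) ≤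
      (578 / 225) ^ 2 * (17 / 16) * (5376 / 3844) * (1 / π ^ 4) / (m : ℝ) ^ 4 + 17 * (578 / 225) ^ 2 * (1 / π ^ 2) * ε ^ 2 := by
  have hπ : 0 < π := Real.pi_pos
  have hmr : (17 : ℝ) ≤ m := by exact_mod_cast hm
  have hm0 : (0 : ℝ) < m := by linarith
  have hm2 : 2 ≤ m := by omega
  have h8m : ¬ 8 * m ≤ (20 : ℕ) := by omega
  have hm8 : m ≠ 8 := by omega
  rw [if_pos hm2, one_mul, if_neg h8m]
  by_cases ho : Odd m
  · rw [if_pos ho]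
    have hw := odd_weight_le_of_ge hm
    have hw0 : 0 ≤ (1 / (π * ((8 : ℝ) + m)) + 1 / (π * |(8 : ℝ) - m|)) ^ 2 := sq_nonneg _
    have hcast : (((20 : ℕ) : ℝ) + 1) * (2 * (8 * (m : ℝ)) / (π * ((8 * (m : ℝ)) ^ 2 - ((20 : ℕ) : ℝ) ^ 2))) ^ 2 =
        21 * (16 * (m : ℝ)) ^ 2 / ((8 * (m : ℝ)) ^ 2 - 400) ^ 2 * (1 / π ^ 2) := by
      have hden : 0 < (8 * (m : ℝ)) ^ 2 - 400 := by nlinarith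
      push_cast
      field_simp
      ring
    rw [hcast]
    set L : ℝ := 21 * (16 * (m : ℝ)) ^ 2 / ((8 * (m : ℝ)) ^ 2 - 400) ^ 2 * (1 / π ^ 2) with hLdef
    have hL0 : 0 ≤ L := by positivity
    have hL : L ≤ 5376 / 3844 / (m : ℝ) ^ 2 * (1 / π ^ 2) := by
      rw [hLdef]
      refine mul_le_mul_of_nonneg_right ?_ (by positivity)
      have hden : 62 * (m : ℝ) ^ 2 ≤ (8 * (m : ℝ)) ^ 2 - 400 := by nlinarith
      have hden0 : 0 < 62 * (m : ℝ) ^ 2 := by positivity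
      have hD : 0 < ((8 * (m : ℝ)) ^ 2 - 400) ^ 2 := pow_pos (by linarith) 2
      rw [div_le_div_iff₀ hD (by positivity)]
      have h1 : (62 * (m : ℝ) ^ 2) ^ 2 ≤ ((8 * (m : ℝ)) ^ 2 - 400) ^ 2 := pow_le_pow_left₀ hden0.le hden 2
      nlinarith [h1]
    have hmin : min 1 ((Real.sqrt L + m * ε) ^ 2) ≤ 17 / 16 * L + 17 * (m * ε) ^ 2 :=
      (min_le_right _ _).trans (sq_sqrt_add_le hL0)
    have hR0 : 0 ≤ 17 / 16 * L + 17 * ((m : ℝ) * ε) ^ 2 := by positivity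
    calc (1 / (π * ((8 : ℝ) + m)) + 1 / (π * |(8 : ℝ) - m|)) ^ 2 * min 1 ((Real.sqrt L + m * ε) ^ 2)
        ≤ (1 / (π * ((8 : ℝ) + m)) + 1 / (π * |(8 : ℝ) - m|)) ^ 2 * (17 / 16 * L + 17 * (m * ε) ^ 2) :=
          mul_le_mul_of_nonneg_left hmin hw0
      _ ≤ ((578 / 225) ^ 2 * (1 / π ^ 2) / (m : ℝ) ^ 2) * (17 / 16 * (5376 / 3844 / (m : ℝ) ^ 2 * (1 / π ^ 2)) + 17 * (m * ε) ^ 2) :=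
          mul_le_mul hw (by nlinarith [hL]) hR0 (by positivity)
      _ = _ := by field_simp
  · rw [if_neg ho, if_neg hm8, zero_mul]
    positivity

/-- The main lobe `m = 8`: `β₂₀(8) ≤ (17/64)·(21·128²/3696²)·(1/π²) + 272ε²`. [folklore] -/
theorem strip20_term_eight_le {ε : ℝ} :
    (if 2 ≤ 8 then (1 : ℝ) else 0) *
        ((if Odd 8 then (1 / (π * ((8 : ℝ) + (8 : ℕ))) + 1 / (π * |(8 : ℝ) - (8 : ℕ)|)) ^ 2 else if (8 : ℕ) = 8 then (1 / 4 : ℝ) else 0) *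
          min 1 ((Real.sqrt (if 8 * 8 ≤ (20 : ℕ) then (1 : ℝ) else
            (((20 : ℕ) : ℝ) + 1) * (2 * (8 * ((8 : ℕ) : ℝ)) / (π * ((8 * ((8 : ℕ) : ℝ)) ^ 2 - ((20 : ℕ) : ℝ) ^ 2))) ^ 2) + (8 : ℕ) * ε) ^ 2)) ≤
      17 / 64 * (21 * 128 ^ 2 / 3696 ^ 2) * (1 / π ^ 2) + 272 * ε ^ 2 := by
  have hπ : 0 < π := Real.pi_pos
  have h8 : ¬ Odd 8 := by decide
  rw [if_pos (by norm_num : 2 ≤ 8), one_mul, if_neg h8, if_pos rfl, if_neg (by norm_num : ¬ 8 * 8 ≤ (20 : ℕ))]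
  have hcast : (((20 : ℕ) : ℝ) + 1) * (2 * (8 * ((8 : ℕ) : ℝ)) / (π * ((8 * ((8 : ℕ) : ℝ)) ^ 2 - ((20 : ℕ) : ℝ) ^ 2))) ^ 2 =
      21 * 128 ^ 2 / 3696 ^ 2 * (1 / π ^ 2) := by
    push_cast
    field_simp
    ring
  rw [hcast]
  have hL0 : (0 : ℝ) ≤ 21 * 128 ^ 2 / 3696 ^ 2 * (1 / π ^ 2) := by positivity
  have hmin := (min_le_right (1 : ℝ) _).trans (sq_sqrt_add_le (x := ((8 : ℕ) : ℝ) * ε) hL0)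
  calc (1 / 4 : ℝ) * min 1 ((Real.sqrt (21 * 128 ^ 2 / 3696 ^ 2 * (1 / π ^ 2)) + (8 : ℕ) * ε) ^ 2)
      ≤ 1 / 4 * (17 / 16 * (21 * 128 ^ 2 / 3696 ^ 2 * (1 / π ^ 2)) + 17 * (((8 : ℕ) : ℝ) * ε) ^ 2) :=
        mul_le_mul_of_nonneg_left hmin (by norm_num)
    _ = _ := by push_cast; ring

/-! ## §2 Head, middle, tail -/

/-- **Head** (`m ≤ 16`): at most `0.00299 + 11815ε²`. [folklore] -/
theorem sum_strip20_head_le {ε : ℝ} (T : Finset ℕ) :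
    ∑ m ∈ T.filter (· ≤ 16), (if 2 ≤ m then (1 : ℝ) else 0) *
        ((if Odd m then (1 / (π * ((8 : ℝ) + m)) + 1 / (π * |(8 : ℝ) - m|)) ^ 2 else if m = 8 then (1 / 4 : ℝ) else 0) *
          min 1 ((Real.sqrt (if 8 * m ≤ (20 : ℕ) then (1 : ℝ) else
            (((20 : ℕ) : ℝ) + 1) * (2 * (8 * (m : ℝ)) / (π * ((8 * (m : ℝ)) ^ 2 - ((20 : ℕ) : ℝ) ^ 2))) ^ 2) + m * ε) ^ 2)) ≤
      0.00299 + 11815 * ε ^ 2 := by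
  classical
  set f : ℕ → ℝ := fun m => (if 2 ≤ m then (1 : ℝ) else 0) *
    ((if Odd m then (1 / (π * ((8 : ℝ) + m)) + 1 / (π * |(8 : ℝ) - m|)) ^ 2 else if m = 8 then (1 / 4 : ℝ) else 0) *
      min 1 ((Real.sqrt (if 8 * m ≤ (20 : ℕ) then (1 : ℝ) else
        (((20 : ℕ) : ℝ) + 1) * (2 * (8 * (m : ℝ)) / (π * ((8 * (m : ℝ)) ^ 2 - ((20 : ℕ) : ℝ) ^ 2))) ^ 2) + m * ε) ^ 2)) with hf
  -- the explicit majorant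
  set g : ℕ → ℝ := fun m => if m < 3 then 0 else if Odd m then
      17 / 16 * ((1 / ((8 : ℝ) + m) + 1 / |(8 : ℝ) - m|) ^ 2 * (21 * (16 * (m : ℝ)) ^ 2 / ((8 * (m : ℝ)) ^ 2 - 400) ^ 2)) *
        (1 / π ^ 4) + 17 * (m : ℝ) ^ 2 * ε ^ 2
    else if m = 8 then 17 / 64 * (21 * 128 ^ 2 / 3696 ^ 2) * (1 / π ^ 2) + 272 * ε ^ 2 else 0 with hg
  have hf0 : ∀ m, 0 ≤ f m := fun m => by
    simp only [hf]
    exact mul_nonneg (by split_ifs <;> norm_num) (mul_nonneg (by split_ifs <;> positivity) (le_min zero_le_one (sq_nonneg _)))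
  have hle : ∀ m : ℕ, f m ≤ g m := by
    intro m
    simp only [hg]
    by_cases h3 : m < 3
    · rw [if_pos h3]
      simp only [hf]
      by_cases h2 : 2 ≤ m
      · have hm2 : m = 2 := by omega
        subst hm2
        rw [if_neg (by decide : ¬ Odd 2), if_neg (by norm_num : (2:ℕ) ≠ 8)]
        simp
      · rw [if_neg h2]; simp
    · rw [if_neg h3]
      push Not at h3
      by_cases ho : Odd m
      · rw [if_pos ho]; exact strip20_term_le_of_odd ho h3
      · rw [if_neg ho]
        by_cases h8 : m = 8
        · rw [if_pos h8]; subst h8; exact strip20_term_eight_le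
        · rw [if_neg h8]
          simp only [hf]
          rw [if_neg ho, if_neg h8]
          simp
  have hg0 : ∀ m, 0 ≤ g m := fun m => by
    simp only [hg]
    split_ifs
    · exact le_rfl
    · have : 0 < (8 * (m : ℝ)) ^ 2 - 400 ∨ True := Or.inr trivial
      positivity
    · positivity
    · exact le_rfl
  have hsub : T.filter (· ≤ 16) ⊆ Finset.range 17 := by
    intro m hm
    rw [Finset.mem_filter] at hm
    exact Finset.mem_range.2 (by omega)
  calc ∑ m ∈ T.filter (· ≤ 16), f m ≤ ∑ m ∈ T.filter (· ≤ 16), g m := Finset.sum_le_sum fun m _ => hle m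
    _ ≤ ∑ m ∈ Finset.range 17, g m := Finset.sum_le_sum_of_subset_of_nonneg hsub fun m _ _ => hg0 m
    _ ≤ 0.00299 + 11815 * ε ^ 2 := by
        have hA : (π ^ 4)⁻¹ ≤ 0.010267 := by rw [← one_div]; exact inv_pi_pow_four_le
        have hB : (π ^ 2)⁻¹ ≤ 0.101322 := by rw [← one_div]; exact inv_pi_sq_le
        have hA0 : 0 ≤ (π ^ 4)⁻¹ := by positivity
        have hB0 : 0 ≤ (π ^ 2)⁻¹ := by positivity
        have hε0 : 0 ≤ ε ^ 2 := sq_nonneg ε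
        simp only [Finset.sum_range_succ, Finset.sum_range_zero, hg]
        norm_num [Nat.odd_iff]
        linarith

/-- **Middle** (`17 ≤ m ≤ 2²⁰`): at most `(578/225)²(17/16)(5376/3844)/289·(1/π⁴)·(1/16) + 2²⁰·17(578/225)²(1/π²)ε²`. [folklore] -/
theorem sum_strip20_middle_le {ε : ℝ} (T : Finset ℕ) :
    ∑ m ∈ T.filter (fun m => 17 ≤ m ∧ m ≤ 1048576), (if 2 ≤ m then (1 : ℝ) else 0) *
        ((if Odd m then (1 / (π * ((8 : ℝ) + m)) + 1 / (π * |(8 : ℝ) - m|)) ^ 2 else if m = 8 then (1 / 4 : ℝ) else 0) *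
          min 1 ((Real.sqrt (if 8 * m ≤ (20 : ℕ) then (1 : ℝ) else
            (((20 : ℕ) : ℝ) + 1) * (2 * (8 * (m : ℝ)) / (π * ((8 * (m : ℝ)) ^ 2 - ((20 : ℕ) : ℝ) ^ 2))) ^ 2) + m * ε) ^ 2)) ≤
      (578 / 225) ^ 2 * (17 / 16) * (5376 / 3844) / 289 * (1 / π ^ 4) * (1 / 16) +
        1048576 * (17 * (578 / 225) ^ 2 * (1 / π ^ 2) * ε ^ 2) := by
  classical
  set T₂ := T.filter (fun m => 17 ≤ m ∧ m ≤ 1048576) with hT₂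
  have hmem : ∀ m ∈ T₂, 17 ≤ m ∧ m ≤ 1048576 := fun m hm => (Finset.mem_filter.1 hm).2
  have h1 := Finset.sum_le_sum fun m (hm : m ∈ T₂) => strip20_term_le_of_ge (hmem m hm).1 (ε := ε)
  refine h1.trans ?_
  rw [Finset.sum_add_distrib]
  have h2 : ∑ m ∈ T₂, (578 / 225 : ℝ) ^ 2 * (17 / 16) * (5376 / 3844) * (1 / π ^ 4) / (m : ℝ) ^ 4 ≤
      (578 / 225) ^ 2 * (17 / 16) * (5376 / 3844) / 289 * (1 / π ^ 4) * (1 / 16) := by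
    have hterm : ∀ m ∈ T₂, (578 / 225 : ℝ) ^ 2 * (17 / 16) * (5376 / 3844) * (1 / π ^ 4) / (m : ℝ) ^ 4 ≤
        (578 / 225) ^ 2 * (17 / 16) * (5376 / 3844) / 289 * (1 / π ^ 4) * ((m : ℝ) ^ 2)⁻¹ := by
      intro m hm
      have hm17 : (17 : ℝ) ≤ m := by exact_mod_cast (hmem m hm).1
      have hm0 : (0 : ℝ) < m := by linarith
      have h289 : (289 : ℝ) ≤ (m : ℝ) ^ 2 := by nlinarith
      rw [div_eq_mul_inv]
      have : ((m : ℝ) ^ 4)⁻¹ ≤ 1 / 289 * ((m : ℝ) ^ 2)⁻¹ := by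
        rw [show (m : ℝ) ^ 4 = (m : ℝ) ^ 2 * (m : ℝ) ^ 2 by ring, mul_inv, one_div]
        exact mul_le_mul_of_nonneg_right (inv_anti₀ (by norm_num) h289) (by positivity)
      calc (578 / 225 : ℝ) ^ 2 * (17 / 16) * (5376 / 3844) * (1 / π ^ 4) * ((m : ℝ) ^ 4)⁻¹
          ≤ (578 / 225 : ℝ) ^ 2 * (17 / 16) * (5376 / 3844) * (1 / π ^ 4) * (1 / 289 * ((m : ℝ) ^ 2)⁻¹) := by gcongr
        _ = _ := by ring
    refine (Finset.sum_le_sum hterm).trans ?_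
    rw [← Finset.mul_sum]
    refine mul_le_mul_of_nonneg_left ?_ (by positivity)
    have hsub : T₂ ⊆ Finset.Ioc 16 1048576 := by
      intro m hm; rw [Finset.mem_Ioc]; have := hmem m hm; omega
    calc ∑ m ∈ T₂, ((m : ℝ) ^ 2)⁻¹ ≤ ∑ m ∈ Finset.Ioc (16 : ℕ) 1048576, ((m : ℝ) ^ 2)⁻¹ :=
          Finset.sum_le_sum_of_subset_of_nonneg hsub fun m _ _ => by positivity
      _ ≤ ((16 : ℕ) : ℝ)⁻¹ - ((1048576 : ℕ) : ℝ)⁻¹ :=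
          sum_Ioc_inv_sq_le_sub (α := ℝ) (k := 16) (n := 1048576) (by norm_num) (by norm_num)
      _ ≤ 1 / 16 := by norm_num
  have h3 : ∑ m ∈ T₂, (17 : ℝ) * (578 / 225) ^ 2 * (1 / π ^ 2) * ε ^ 2 ≤
      1048576 * (17 * (578 / 225) ^ 2 * (1 / π ^ 2) * ε ^ 2) := by
    rw [Finset.sum_const, nsmul_eq_mul]
    refine mul_le_mul_of_nonneg_right ?_ (by positivity)
    have hcard : T₂.card ≤ (Finset.Ioc 16 1048576).card :=
      Finset.card_le_card fun m hm => by rw [Finset.mem_Ioc]; have := hmem m hm; omega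
    rw [Nat.card_Ioc] at hcard
    exact_mod_cast hcard.trans (by norm_num)
  linarith

/-- **Tail** (`m > 2²⁰`): at most `(578/225)²·(1/π²)/2²⁰`. [folklore] -/
theorem sum_strip20_tail_le {ε : ℝ} (T : Finset ℕ) :
    ∑ m ∈ T.filter (fun m => 1048576 < m), (if 2 ≤ m then (1 : ℝ) else 0) *
        ((if Odd m then (1 / (π * ((8 : ℝ) + m)) + 1 / (π * |(8 : ℝ) - m|)) ^ 2 else if m = 8 then (1 / 4 : ℝ) else 0) *
          min 1 ((Real.sqrt (if 8 * m ≤ (20 : ℕ) then (1 : ℝ) else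
            (((20 : ℕ) : ℝ) + 1) * (2 * (8 * (m : ℝ)) / (π * ((8 * (m : ℝ)) ^ 2 - ((20 : ℕ) : ℝ) ^ 2))) ^ 2) + m * ε) ^ 2)) ≤
      (578 / 225) ^ 2 * (1 / π ^ 2) * (1 / 1048576) := by
  classical
  set T₃ := T.filter (fun m => 1048576 < m) with hT₃
  have hmem : ∀ m ∈ T₃, 1048576 < m := fun m hm => (Finset.mem_filter.1 hm).2
  -- termwise: the cap, then the weight bound
  have hterm : ∀ m ∈ T₃, (if 2 ≤ m then (1 : ℝ) else 0) *
      ((if Odd m then (1 / (π * ((8 : ℝ) + m)) + 1 / (π * |(8 : ℝ) - m|)) ^ 2 else if m = 8 then (1 / 4 : ℝ) else 0) *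
        min 1 ((Real.sqrt (if 8 * m ≤ (20 : ℕ) then (1 : ℝ) else
          (((20 : ℕ) : ℝ) + 1) * (2 * (8 * (m : ℝ)) / (π * ((8 * (m : ℝ)) ^ 2 - ((20 : ℕ) : ℝ) ^ 2))) ^ 2) + m * ε) ^ 2)) ≤
      (578 / 225) ^ 2 * (1 / π ^ 2) * ((m : ℝ) ^ 2)⁻¹ := by
    intro m hm
    have hm17 : 17 ≤ m := by have := hmem m hm; omega
    refine (strip20_term_le_weight m).trans ?_
    by_cases ho : Odd m
    · rw [if_pos ho]
      exact (odd_weight_le_of_ge hm17).trans (le_of_eq (by rw [div_eq_mul_inv]))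
    · rw [if_neg ho, if_neg (by omega : m ≠ 8)]; positivity
  refine (Finset.sum_le_sum hterm).trans ?_
  rw [← Finset.mul_sum]
  refine mul_le_mul_of_nonneg_left ?_ (by positivity)
  -- the inverse-square tail beyond `2²⁰`
  rcases T₃.eq_empty_or_nonempty with h | h
  · rw [h, Finset.sum_empty]; norm_num
  · set M := T₃.max' h with hM
    have hsub : T₃ ⊆ Finset.Ioc 1048576 M := by
      intro m hm; rw [Finset.mem_Ioc]; exact ⟨hmem m hm, Finset.le_max' _ _ hm⟩
    have hM1 : 1048576 ≤ M := by
      obtain ⟨m, hm⟩ := h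
      exact (hmem m hm).le.trans (Finset.le_max' _ _ hm)
    calc ∑ m ∈ T₃, ((m : ℝ) ^ 2)⁻¹ ≤ ∑ m ∈ Finset.Ioc (1048576 : ℕ) M, ((m : ℝ) ^ 2)⁻¹ :=
          Finset.sum_le_sum_of_subset_of_nonneg hsub fun m _ _ => by positivity
      _ ≤ ((1048576 : ℕ) : ℝ)⁻¹ - ((M : ℕ) : ℝ)⁻¹ :=
          sum_Ioc_inv_sq_le_sub (α := ℝ) (k := 1048576) (n := M) (by norm_num) hM1
      _ ≤ 1 / 1048576 := by
          have h0 : (0 : ℝ) ≤ ((M : ℕ) : ℝ)⁻¹ := by positivity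
          have e : ((1048576 : ℕ) : ℝ)⁻¹ = 1 / 1048576 := by norm_num
          rw [e]; linarith

/-! ## §3 The series bound -/

/-- **THE NUMERIC SERIES OF THE STRIP `S_1(20)`**: for `0 ≤ ε ≤ 2⁻²⁵` and every finite `T ⊆ ℕ`, `Σ_{m∈T} β₂₀(m) ≤ 31/10000`
(the `hB` hypothesis of `K1Start.phaseOne_strip_le_of_series` at `K = 20`, `B = 31/10000`). [folklore] -/
theorem sum_strip20_series_le {ε : ℝ} (hε0 : 0 ≤ ε) (hε : ε ≤ (2 : ℝ)⁻¹ ^ 25) (T : Finset ℕ) :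
    ∑ m ∈ T, (if 2 ≤ m then (1 : ℝ) else 0) *
        ((if Odd m then (1 / (π * ((8 : ℝ) + m)) + 1 / (π * |(8 : ℝ) - m|)) ^ 2 else if m = 8 then (1 / 4 : ℝ) else 0) *
          min 1 ((Real.sqrt (if 8 * m ≤ (20 : ℕ) then (1 : ℝ) else
            (((20 : ℕ) : ℝ) + 1) * (2 * (8 * (m : ℝ)) / (π * ((8 * (m : ℝ)) ^ 2 - ((20 : ℕ) : ℝ) ^ 2))) ^ 2) + m * ε) ^ 2)) ≤
      31 / 10000 := by
  classical
  set f : ℕ → ℝ := fun m => (if 2 ≤ m then (1 : ℝ) else 0) *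
    ((if Odd m then (1 / (π * ((8 : ℝ) + m)) + 1 / (π * |(8 : ℝ) - m|)) ^ 2 else if m = 8 then (1 / 4 : ℝ) else 0) *
      min 1 ((Real.sqrt (if 8 * m ≤ (20 : ℕ) then (1 : ℝ) else
        (((20 : ℕ) : ℝ) + 1) * (2 * (8 * (m : ℝ)) / (π * ((8 * (m : ℝ)) ^ 2 - ((20 : ℕ) : ℝ) ^ 2))) ^ 2) + m * ε) ^ 2)) with hf
  have hsplit : ∑ m ∈ T, f m = ∑ m ∈ T.filter (· ≤ 16), f m +
      (∑ m ∈ T.filter (fun m => 17 ≤ m ∧ m ≤ 1048576), f m + ∑ m ∈ T.filter (fun m => 1048576 < m), f m) := by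
    rw [← Finset.sum_filter_add_sum_filter_not T (· ≤ 16)]
    congr 1
    rw [← Finset.sum_filter_add_sum_filter_not (T.filter fun m => ¬ m ≤ 16) (· ≤ 1048576), Finset.filter_filter,
      Finset.filter_filter]
    congr 1
    · exact Finset.sum_congr (Finset.filter_congr fun m _ => by omega) fun _ _ => rfl
    · exact Finset.sum_congr (Finset.filter_congr fun m _ => by omega) fun _ _ => rfl
  have hH := sum_strip20_head_le (ε := ε) T
  have hMid := sum_strip20_middle_le (ε := ε) T
  have hTail := sum_strip20_tail_le (ε := ε) T
  have hA := inv_pi_pow_four_le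
  have hB := inv_pi_sq_le
  have hA0 : 0 ≤ 1 / π ^ 4 := by positivity
  have hB0 : 0 ≤ 1 / π ^ 2 := by positivity
  have hε2 : ε ^ 2 ≤ ((2 : ℝ)⁻¹ ^ 25) ^ 2 := pow_le_pow_left₀ hε0 hε 2
  change ∑ m ∈ T, f m ≤ 31 / 10000
  rw [hsplit]
  simp only [hf] at hH hMid hTail ⊢
  nlinarith [hH, hMid, hTail, sq_nonneg ε]

end Summit.AnomalousDissipation.AnomalousDissipation.Theorems.SawtoothPulseCascade.K1Start
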